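import Mathlib
import Literature.Barriers.MatrixMultiplication.QuasirandomBarrierProofs
import Summits.MatrixMultiplication.MatrixMultiplication.Theorems.SnSubsetDichotomyGlobalBranchStubBlockDictionary
import Summits.MatrixMultiplication.MatrixMultiplication.Theorems.SnSubsetDichotomyPolynomialSlackLowBlocks

/-!
# The excess cap: Parseval at the standard block of `ℂ[S_n]`

Helper file for the LEVEL-ONE programme on the crux `SnSubsetDichotomy.PolynomialSlack`
(stmt-MatrixMultiplication-8306; idea card `deficit-budget-positivity`, "EXCESS CAP"). For a set
`X ⊆ S_n` let `M_X(i,j) = #{x ∈ X : x j = i}` be its marginal (umvirate) counts, an `n × n` matrix with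
row and column sums `|X|`. The level-one energy of `X` is `Σ_{i,j} M_X(i,j)² - |X|²·n/n … `; precisely
`Σ_{x,y ∈ X} (fix(x⁻¹y) - 1) = Σ_{i,j} M_X(i,j)² - |X|²` (`sum_fix_eq_sum_sq`), and this is the
Hilbert–Schmidt mass of `𝟙_X` at the standard block `(n-1,1)` of `ℂ[S_n]`. Parseval
(`parseval_of_adjoint`: `Σᵢ dᵢ‖φ(𝟙_X)ᵢ‖² = n!·|X|`), the trivial block (`|X|²`) and the non-negativity
of all other blocks give the **excess cap**

  `(n-1)·Σ_{i,j} M_X(i,j)² ≤ |X|·(n! + (n-2)|X|)`     (`excess_cap`, every `X ⊆ S_n`, `n ≥ 40`),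

i.e. `‖D_X - J/n‖_F² ≤ (1-μ)/((n-1)μ)` for the doubly stochastic `D_X = M_X/|X|`, `μ = |X|/n!`: level-one
bumps of a sparse set are "legal" up to this (large) cap, whereas DEFICITS are priced by entropy
(the deficit budget, next files).
-/

namespace Summit.MatrixMultiplication.MatrixMultiplication.Theorems.PolynomialSlack

open scoped BigOperators Matrix ComplexOrder
open Literature.Combinatorics.Additive (indicatorElem indicatorElemInv indicatorElem_def
  indicatorElemInv_def sum_single_mul_sum_single coeff_one_sum_single)
open Literature.NumberTheory.DiophantineGeometry (spechtCharacter numStandardTableaux)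
open Literature.RepresentationTheory.FiniteGroups
open Literature.Barriers.MatrixMultiplication
open Summit.MatrixMultiplication.MatrixMultiplication.Theorems.GlobalBranch (stub_blockDictionary)

-- `Summit.<Summit>.<Problem>` is the tree's mandated summit-side namespace (CONVENTIONS §2); for
-- this single-conjunct summit the two coincide, so each declaration silences `dupNamespace`.
set_option linter.dupNamespace false

/-! ## Fixed points of quotients as squared marginals -/

/-- **`Σ_{x,y ∈ X} fix(x⁻¹y) = Σ_{i,j} M_X(i,j)²`**: both count the triples `(x, y, p)` with
`x p = y p`, grouped by `p` and the common value `i = x p`. [folklore] -/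
theorem sum_fix_eq_sum_sq {n : ℕ} (X : Finset (Equiv.Perm (Fin n))) :
    ∑ x ∈ X, ∑ y ∈ X, (Finset.univ.filter fun p : Fin n => (x⁻¹ * y) p = p).card =
      ∑ i : Fin n, ∑ j : Fin n, (X.filter fun x => x j = i).card ^ 2 := by
  classical
  -- the fixed points of `x⁻¹ y` are the agreements of `x` and `y`
  have h1 : ∀ x y : Equiv.Perm (Fin n), (Finset.univ.filter fun p : Fin n => (x⁻¹ * y) p = p).card =
      ∑ p : Fin n, if y p = x p then 1 else 0 := by
    intro x y
    rw [Finset.card_filter]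
    refine Finset.sum_congr rfl fun p _ => ?_
    simp only [Equiv.Perm.mul_apply, Equiv.Perm.inv_eq_iff_eq]
  simp_rw [h1]
  -- both sides are `Σ_p Σ_{x,y ∈ X} [y p = x p]`
  calc ∑ x ∈ X, ∑ y ∈ X, ∑ p : Fin n, (if y p = x p then (1 : ℕ) else 0)
      = ∑ x ∈ X, ∑ p : Fin n, ∑ y ∈ X, (if y p = x p then (1 : ℕ) else 0) :=
        Finset.sum_congr rfl fun x _ => Finset.sum_comm
    _ = ∑ p : Fin n, ∑ x ∈ X, ∑ y ∈ X, (if y p = x p then (1 : ℕ) else 0) := Finset.sum_comm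
    _ = ∑ p : Fin n, ∑ i : Fin n, (X.filter fun x => x p = i).card ^ 2 := by
        refine Finset.sum_congr rfl fun p _ => ?_
        -- `Σ_i #{x : x p = i}² = Σ_{x,y} Σ_i [x p = i][y p = i] = Σ_{x,y} [y p = x p]`
        have h2 : ∀ i : Fin n, (X.filter fun x => x p = i).card ^ 2 =
            ∑ x ∈ X, ∑ y ∈ X, (if x p = i then (1 : ℕ) else 0) * (if y p = i then (1 : ℕ) else 0) := by
          intro i
          rw [sq, Finset.card_filter, Finset.sum_mul_sum]
        simp_rw [h2]
        symm
        calc ∑ i : Fin n, ∑ x ∈ X, ∑ y ∈ X, (if x p = i then (1 : ℕ) else 0) * (if y p = i then (1 : ℕ) else 0)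
            = ∑ x ∈ X, ∑ i : Fin n, ∑ y ∈ X,
                (if x p = i then (1 : ℕ) else 0) * (if y p = i then (1 : ℕ) else 0) := Finset.sum_comm
          _ = ∑ x ∈ X, ∑ y ∈ X, ∑ i : Fin n,
                (if x p = i then (1 : ℕ) else 0) * (if y p = i then (1 : ℕ) else 0) :=
              Finset.sum_congr rfl fun x _ => Finset.sum_comm
          _ = ∑ x ∈ X, ∑ y ∈ X, (if y p = x p then (1 : ℕ) else 0) := by
              refine Finset.sum_congr rfl fun x _ => Finset.sum_congr rfl fun y _ => ?_
              rw [Finset.sum_eq_single (x p) (fun i _ hi => by rw [if_neg (Ne.symm hi), zero_mul])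
                (fun h => absurd (Finset.mem_univ _) h), if_pos rfl, one_mul]
    _ = ∑ i : Fin n, ∑ j : Fin n, (X.filter fun x => x j = i).card ^ 2 := Finset.sum_comm

/-- The coefficient at `1` of `𝟙_{X⁻¹}𝟙_X` is `|X|`. [folklore] -/
theorem coeff_one_indicatorElemInv_mul {G : Type} [Group G] [DecidableEq G] (X : Finset G) :
    (indicatorElemInv ℂ X * indicatorElem ℂ X).coeff 1 = (X.card : ℂ) := by
  rw [indicatorElemInv_def, indicatorElem_def, sum_single_mul_sum_single, coeff_one_sum_single]
  congr 1
  have : ((X ×ˢ X).filter fun p : G × G => p.1⁻¹ * p.2 = 1) = X.diag := by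
    ext ⟨x, y⟩
    simp only [Finset.mem_filter, Finset.mem_product, Finset.mem_diag, inv_mul_eq_one]
    constructor
    · rintro ⟨⟨hx, -⟩, rfl⟩; exact ⟨hx, rfl⟩
    · rintro ⟨hx, rfl⟩; exact ⟨⟨hx, hx⟩, rfl⟩
  rw [this, Finset.diag_card]

set_option maxHeartbeats 400000 in
/-- **The excess cap** (Parseval at the standard block): for every `X ⊆ S_n`, `n ≥ 40`,
`(n-1)·Σ_{i,j} #{x ∈ X : x j = i}² ≤ |X|·(n! + (n-2)·|X|)`. [folklore] -/
theorem excess_cap (n : ℕ) (hn : 40 ≤ n) (X : Finset (Equiv.Perm (Fin n))) :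
    ((n : ℝ) - 1) * ∑ i : Fin n, ∑ j : Fin n, ((X.filter fun x => x j = i).card : ℝ) ^ 2 ≤
      (X.card : ℝ) * ((n.factorial : ℝ) + ((n : ℝ) - 2) * X.card) := by
  classical
  have hn1 : 1 ≤ n := by omega
  have hn2 : 2 ≤ n := by omega
  -- a unitary Wedderburn decomposition and its dictionary with partitions
  obtain ⟨r, d, hd, φ, hφ⟩ := exists_unitary_algEquiv_pi_matrix (Equiv.Perm (Fin n))
  haveI : ∀ i, NeZero (d i) := hd
  obtain ⟨part, hbij, hchar, -, -, hnorm⟩ := stub_blockDictionary n φ hφ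
  -- Parseval for `𝟙_X`
  have hP : ∑ i, (d i : ℝ) * ((φ (indicatorElem ℂ X) i)ᴴ * φ (indicatorElem ℂ X) i).trace.re =
      (n.factorial : ℝ) * X.card := by
    have h := parseval_of_adjoint φ (indicatorElem ℂ X) (indicatorElemInv ℂ X) fun i =>
      algEquiv_indicatorElemInv_eq_conjTranspose φ hφ X i
    rw [coeff_one_indicatorElemInv_mul, Fintype.card_perm, Fintype.card_fin] at h
    exact_mod_cast h
  -- the two low blocks `(n)` and `(n-1,1)`
  obtain ⟨μ₁, hμ₁⟩ := exists_partition_single hn1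
  obtain ⟨μ₂, hμ₂⟩ := exists_partition_hook hn2
  obtain ⟨i₁, hi₁⟩ := hbij.2 μ₁
  obtain ⟨i₂, hi₂⟩ := hbij.2 μ₂
  have hs₁ : (part i₁).sortedParts = [n] := by rw [hi₁, hμ₁]
  have hs₂ : (part i₂).sortedParts = [n - 1, 1] := by rw [hi₂, hμ₂]
  have n12 : i₁ ≠ i₂ := fun h => by
    have : ([n] : List ℕ) = [n - 1, 1] := by rw [← hs₁, ← hs₂, h]
    simp at this
  have hchar' : ∀ i, (blockRep φ i).character = spechtCharacter ℂ (part i) := hchar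
  -- block `(n)`: `|X|²`
  have e₁ : (d i₁ : ℝ) * ((φ (indicatorElem ℂ X) i₁)ᴴ * φ (indicatorElem ℂ X) i₁).trace.re =
      (X.card : ℝ) ^ 2 := by
    rw [hnorm i₁ X, degree_of_single φ part hchar' hs₁]
    simp only [spechtCharacter_of_sortedParts_eq_single (part i₁) hs₁, Complex.one_re,
      Finset.sum_const, Nat.cast_one, one_mul]
    ring
  -- block `(n-1,1)`: `(n-1)·(Σ M² - |X|²)`
  have e₂ : (d i₂ : ℝ) * ((φ (indicatorElem ℂ X) i₂)ᴴ * φ (indicatorElem ℂ X) i₂).trace.re =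
      ((n : ℝ) - 1) * (∑ i : Fin n, ∑ j : Fin n, ((X.filter fun x => x j = i).card : ℝ) ^ 2 -
        (X.card : ℝ) ^ 2) := by
    rw [hnorm i₂ X, degree_of_hook φ part hchar' hn2 hs₂, Nat.cast_sub hn1, Nat.cast_one]
    congr 1
    simp only [spechtCharacter_of_sortedParts_eq_hook (part i₂) hn2 hs₂, Complex.sub_re,
      Complex.natCast_re, Complex.one_re, Finset.sum_sub_distrib, Finset.sum_const]
    have h := sum_fix_eq_sum_sq X
    have h' : (∑ x ∈ X, ∑ y ∈ X, ((Finset.univ.filter fun p : Fin n => (x⁻¹ * y) p = p).card : ℝ)) =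
        ∑ i : Fin n, ∑ j : Fin n, ((X.filter fun x => x j = i).card : ℝ) ^ 2 := by
      exact_mod_cast h
    rw [h']
    ring
  -- all blocks are non-negative; single out the two
  have hsplit : ∑ i, (d i : ℝ) * ((φ (indicatorElem ℂ X) i)ᴴ * φ (indicatorElem ℂ X) i).trace.re =
      ∑ i ∈ ({i₁, i₂} : Finset (Fin r)),
          (d i : ℝ) * ((φ (indicatorElem ℂ X) i)ᴴ * φ (indicatorElem ℂ X) i).trace.re +
        ∑ i ∈ Finset.univ \ {i₁, i₂},
          (d i : ℝ) * ((φ (indicatorElem ℂ X) i)ᴴ * φ (indicatorElem ℂ X) i).trace.re := by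
    rw [← Finset.sum_union Finset.disjoint_sdiff, Finset.union_sdiff_of_subset (Finset.subset_univ _)]
  have hrest : 0 ≤ ∑ i ∈ Finset.univ \ {i₁, i₂},
      (d i : ℝ) * ((φ (indicatorElem ℂ X) i)ᴴ * φ (indicatorElem ℂ X) i).trace.re :=
    Finset.sum_nonneg fun i _ => mul_nonneg (Nat.cast_nonneg _) (re_trace_conjTranspose_mul_self_nonneg _)
  rw [hsplit, Finset.sum_pair n12, e₁, e₂] at hP
  nlinarith [hrest, hP]

end Summit.MatrixMultiplication.MatrixMultiplication.Theorems.PolynomialSlack
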